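import Mathlib
import HarnessLib
import Summits.Ventures.LatticeQCDFlow.Scoring.SelfNormalisedReweightingConsistency
import Summits.Ventures.LatticeQCDFlow.Scoring.UStatisticCLT
import Summits.Ventures.LatticeQCDFlow.Scoring.DeltaMethod

/-!
# ASYMPTOTIC NORMALITY of the printed FREE-ENERGY estimate: `√n (log Ẑₙ − log Z) ⇒ N(0, M₂ − 1)`,
# `M₂ − 1 = 1/ESS − 1 = Var_q w` — the central limit theorem for the partition-function column
# pushed through `log` by the delta method

HONEST FRAMING: exact (Metropolis-corrected) sampling algorithms for lattice gauge theory;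
figures of merit are autocorrelation/cost numbers at stated couplings and volumes; no
continuum-physics claim.

Venture `LatticeQCDFlow` (cell pub-lqcd), topic `Scoring`; FANOUT row 4 (`s0-u1-b`, rung S0-B).
A flow code's partition-function column is the mean UNNORMALISED weight
`Ẑₙ = Σ_{i<n} w̃(yᵢ)/n`, `w̃ = Z·p/q` (`p` the normalised target, `Z` the unknown constant), which
is strongly consistent for `Z` (`Scoring/SelfNormalisedReweightingConsistency`,
`unnormalisedMeanWeight_tendsto_ae`); what is reported is the FREE ENERGY `−log Ẑₙ`.  Here:
(i) the CLT for the column itself, `√n (Ẑₙ − Z) ⇒ N(0, Z²(M₂ − 1))` (Mathlib's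
`tendstoInDistribution_inv_sqrt_mul_sum_sub` along the stream; `Var_q w̃ = Z²·Var_q w`,
`Var_q w = M₂ − 1`, `M₂ = ∫ p²/q dμ = 1/ESS`), and (ii) by row 4's delta method
(`Scoring/DeltaMethod`, `g = log`, `g′(Z) = 1/Z`) the law of the printed free energy:
**`√n (log Ẑₙ − log Z) ⇒ N(0, M₂ − 1)`** — the unknown scale drops out and the asymptotic
variance of the free-energy estimate is exactly `1/ESS − 1` per sample.  Printed counterparts
NAMED ONLY (nothing cited as a fact): the delta method (van der Vaart 1998 Thm 3.1); the
`(1/ESS − 1)/n` rule for the log-mean-weight (Kong–Liu–Wong 1994; Shirts–Chodera 2008 for its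
use with reweighting estimators).  NEW WORK of the cell; no definition is introduced.

## Content (`ν = μ.withDensity q`, `w = p/q`, `w̃ = c·w` with `c = Z > 0`, `M₂ = ∫ p²/q dμ`)

* `variance_unnormalisedWeight_stream` — `Var[w̃(y₀)] = c²(M₂ − 1)`;
* **`partitionFunction_clt`** — `√n (Ẑₙ − c) ⇒ c·Y`, `Y ∼ N(0, M₂ − 1)`;
* **`logPartitionFunction_clt`** — `√n (log Ẑₙ − log c) ⇒ Y`.

NOT CLAIMED: a studentised version (plug in `1/Kₙ − 1`; one more Slutsky step); the bias of
`log Ẑₙ` at finite `n` (Jensen); any number of ours re-scored.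
-/

noncomputable section

namespace Summit.Ventures.LatticeQCDFlow.Scoring.CardConsistency

open MeasureTheory ProbabilityTheory Finset Real Filter
open scoped Topology Function

section FreeEnergy

variable {Ω : Type*} [MeasurableSpace Ω] {P : Measure Ω} [IsProbabilityMeasure P]
variable {Ω' : Type*} [MeasurableSpace Ω'] {P' : Measure Ω'} [IsProbabilityMeasure P']
variable {X : Type*} [MeasurableSpace X] {μ : Measure X} {p q : X → ℝ} {y : ℕ → Ω → X}
variable {Y : Ω' → ℝ}

/-- **`Var[w̃(y₀)] = c²(M₂ − 1)`** along the stream, for weights printed as `w̃ = c·p/q`. [ours] -/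
theorem variance_unnormalisedWeight_stream (hym : ∀ j, Measurable (y j))
    (hlaw : ∀ j, Measure.map (y j) P = μ.withDensity fun z => ENNReal.ofReal (q z))
    (hpm : Measurable p) (hpi : Integrable p μ) (hp1 : ∫ z, p z ∂μ = 1) (hq0 : ∀ z, 0 < q z)
    (hqm : Measurable q) (hM2i : Integrable (fun z => p z ^ 2 / q z) μ) {wt : X → ℝ} {c : ℝ}
    (hwt : ∀ z, wt z = c * (p z / q z)) :
    MemLp (fun ω => wt (y 0 ω)) 2 P ∧ ∫ ω, wt (y 0 ω) ∂P = c
      ∧ Var[fun ω => wt (y 0 ω); P] = c ^ 2 * ((∫ z, p z ^ 2 / q z ∂μ) - 1) := by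
  haveI hν : IsProbabilityMeasure (μ.withDensity fun z => ENNReal.ofReal (q z)) :=
    hlaw 0 ▸ Measure.isProbabilityMeasure_map (hym 0).aemeasurable
  have hwf : wt = fun z => c * (p z / q z) := funext hwt
  have hwm : Measurable fun z => p z / q z := hpm.div hqm
  have hwtm : Measurable wt := hwf ▸ hwm.const_mul c
  have hw2 : MemLp wt 2 (μ.withDensity fun z => ENNReal.ofReal (q z)) :=
    hwf ▸ (AllPairsMedian.memLp_weight_model hpm hq0 hqm hM2i).const_mul c
  have hZ2 : MemLp (fun ω => wt (y 0 ω)) 2 P :=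
    ((hlaw 0).symm ▸ hw2 : MemLp wt 2 (Measure.map (y 0) P)).comp_of_map (hym 0).aemeasurable
  have hw := AllPairsVariance.integral_weight_withDensity_eq (μ := μ) hpi hq0 hqm
  have hmean : ∫ ω, wt (y 0 ω) ∂P = c := by
    rw [integral_comp_stream hym hlaw (g := wt) hwtm 0, hwf, integral_const_mul, hw.2, hp1,
      mul_one]
  refine ⟨hZ2, hmean, ?_⟩
  rw [variance_eq_sub hZ2]
  simp only [Pi.pow_apply]
  rw [hmean, integral_comp_stream hym hlaw (g := fun z => wt z ^ 2) (hwtm.pow_const 2) 0]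
  have e : (fun z => wt z ^ 2) = fun z => c ^ 2 * (p z / q z) ^ 2 := by
    funext z
    rw [hwt, mul_pow]
  rw [e, integral_const_mul, AllPairsMedian.integral_sq_weight_model hq0 hqm]
  ring

/-- **CLT FOR THE PARTITION-FUNCTION COLUMN**: with `Ẑₙ = Σ_{i<n} w̃(yᵢ)/n`, `w̃ = c·p/q`,
`p²/q ∈ L¹(μ)` and `Y ∼ N(0, M₂ − 1)`: `√n (Ẑₙ − c) ⇒ c·Y` (limit law `N(0, c²(M₂ − 1))`).
[ours] -/
theorem partitionFunction_clt (hym : ∀ j, Measurable (y j)) (hind : iIndepFun y P)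
    (hlaw : ∀ j, Measure.map (y j) P = μ.withDensity fun z => ENNReal.ofReal (q z))
    (hpm : Measurable p) (hpi : Integrable p μ) (hp1 : ∫ z, p z ∂μ = 1) (hq0 : ∀ z, 0 < q z)
    (hqm : Measurable q) (hM2i : Integrable (fun z => p z ^ 2 / q z) μ) {wt : X → ℝ} {c : ℝ}
    (hwt : ∀ z, wt z = c * (p z / q z))
    (hY : HasLaw Y (gaussianReal 0 ((∫ z, p z ^ 2 / q z ∂μ) - 1).toNNReal) P') :
    TendstoInDistribution (fun (n : ℕ) ω => Real.sqrt n *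
        ((∑ i ∈ range n, wt (y i ω)) / n - c)) atTop (fun ω' => c * Y ω') (fun _ => P) P' := by
  obtain ⟨hZ2, hmean, hvar⟩ := variance_unnormalisedWeight_stream hym hlaw hpm hpi hp1 hq0 hqm
    hM2i hwt
  have hwf : wt = fun z => c * (p z / q z) := funext hwt
  have hwtm : Measurable wt := hwf ▸ (hpm.div hqm).const_mul c
  -- `c·Y ∼ N(0, c²(M₂ − 1)) = N(0, Var w̃(y₀))`
  have hYc : HasLaw (fun ω' => c * Y ω') (gaussianReal 0 (Var[fun ω => wt (y 0 ω); P]).toNNReal)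
      P' := by
    have h := gaussianReal_const_mul hY c
    rw [mul_zero] at h
    have e : NNReal.mk (c ^ 2) (sq_nonneg _) * ((∫ z, p z ^ 2 / q z ∂μ) - 1).toNNReal
        = (Var[fun ω => wt (y 0 ω); P]).toNNReal := by
      rw [hvar, Real.toNNReal_mul (sq_nonneg c)]
      exact congrArg (· * _) (NNReal.eq (by simp [Real.coe_toNNReal _ (sq_nonneg c)]))
    rw [e] at h
    exact h
  have hclt := tendstoInDistribution_inv_sqrt_mul_sum_sub (P := P) (P' := P')
    (X := fun k ω => wt (y k ω)) hYc hZ2 (hind.comp (fun _ => wt) fun _ => hwtm)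
    (fun i => identDistrib_comp_stream hym hlaw (g := wt) hwtm i)
  rw [hmean] at hclt
  refine hclt.congr (fun n => Eventually.of_forall fun ω => ?_) EventuallyEq.rfl
  rcases Nat.eq_zero_or_pos n with hn | hn
  · subst hn
    simp
  · exact (sqrt_mul_div_sub hn _ _).symm

/-- **ASYMPTOTIC NORMALITY OF THE PRINTED FREE ENERGY.**  One independent proposal stream `yᵢ`
(laws `ν = μ.withDensity q`); `p` measurable, integrable, `∫ p dμ = 1`, `p²/q ∈ L¹(μ)`; `q > 0`
measurable; weights printed as `w̃ = c·p/q` with the TRUE normalising constant `c > 0`;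
`Y ∼ N(0, M₂ − 1)`, `M₂ = ∫ p²/q dμ = 1/ESS`.  Then for `Ẑₙ = Σ_{i<n} w̃(yᵢ)/n`:
`√n (log Ẑₙ − log c) ⇒ Y` in distribution — the free-energy estimate `−log Ẑₙ` has asymptotic
variance `(1/ESS − 1)/n`, free of the unknown scale. [ours] (the delta method with `g = log`) -/
theorem logPartitionFunction_clt (hym : ∀ j, Measurable (y j)) (hind : iIndepFun y P)
    (hlaw : ∀ j, Measure.map (y j) P = μ.withDensity fun z => ENNReal.ofReal (q z))
    (hpm : Measurable p) (hpi : Integrable p μ) (hp1 : ∫ z, p z ∂μ = 1) (hq0 : ∀ z, 0 < q z)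
    (hqm : Measurable q) (hM2i : Integrable (fun z => p z ^ 2 / q z) μ) {wt : X → ℝ} {c : ℝ}
    (hc : 0 < c) (hwt : ∀ z, wt z = c * (p z / q z))
    (hY : HasLaw Y (gaussianReal 0 ((∫ z, p z ^ 2 / q z ∂μ) - 1).toNNReal) P') :
    TendstoInDistribution (fun (n : ℕ) ω => Real.sqrt n *
        (Real.log ((∑ i ∈ range n, wt (y i ω)) / n) - Real.log c)) atTop Y (fun _ => P) P' := by
  have hwf : wt = fun z => c * (p z / q z) := funext hwt
  have hwtm : Measurable wt := hwf ▸ (hpm.div hqm).const_mul c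
  have hclt := partitionFunction_clt (P' := P') hym hind hlaw hpm hpi hp1 hq0 hqm hM2i hwt hY
  have hXm : ∀ n : ℕ, AEMeasurable (fun ω => (∑ i ∈ range n, wt (y i ω)) / (n : ℝ)) P := fun n =>
    ((Finset.measurable_sum _ fun i _ => hwtm.comp (hym i)).div_const _).aemeasurable
  have hdelta := tendstoInDistribution_deltaMethod (P := P) (P' := P')
    (Real.tendsto_sqrt_atTop.comp tendsto_natCast_atTop_atTop) hclt hXm
    (Real.hasDerivAt_log hc.ne') Real.measurable_log
  refine hdelta.congr (fun n => Eventually.of_forall fun ω => rfl)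
    (Eventually.of_forall fun ω' => ?_)
  show c⁻¹ * (c * Y ω') = Y ω'
  rw [← mul_assoc, inv_mul_cancel₀ hc.ne', one_mul]

end FreeEnergy

end Summit.Ventures.LatticeQCDFlow.Scoring.CardConsistency

end
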